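import Summits.HodgeConjecture.CorCM.IrreducibleOddWeightsOrbitBalanceCMFields
import Summits.HodgeConjecture.CorCM.IrreducibleOddWeightsProductSpanConverse
import Literature.NumberTheory.ComplexMultiplication.CMTypeRankSameSlotFamilies
import Mathlib.LinearAlgebra.Matrix.Rank
import HarnessLib

/-!
# ORBIT BALANCE, the CONVERSE for a Galois pivot: a NONDEGENERATE partner with CM by a GALOIS subfield `M ⊆ K_A` has
# `Hg(A × B) = Hg(A) × Hg(B)` ONLY IF the type of `A` is equidistributed over `M` — an exact criterion

COR-CM (cell `pub-hodgecm2`, binder seat `b16` gen 62, count-neutral claim ORBIT BALANCE, file O7 — abstract `G`-set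
level, CM fields and realisations; theorems only, no definition, no named fact, no `sorry`).  NEW as stated, hence under
`Summits/`.  HONEST FRAMING: unconditional statements about `dim MT` and about which Hodge classes on products are sums
of products; no Hodge class is claimed algebraic or not; `HC_CM` is neither used nor asserted.

File O3 (`cmFamilyRank_add_card_eq_pair_of_shadow_eq_zero`): `K_{i₁} = M` normal, `j : M → K_{i₀}`, `Φ_{i₀}`
equidistributed over `M` ⟹ `Hg(A₀ × A₁) = Hg(A₀) × Hg(A₁)` for EVERY type `Φ_{i₁}` of `M`.  THIS FILE proves the converse
when `M` is GALOIS over `ℚ` (imaginary quadratic, biquadratic, cyclotomic, any abelian or non-abelian Galois CM field) and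
`Φ_{i₁}` is NONDEGENERATE:

* §1 **`IrrOdd.not_map_slotExt_le_of_eval_eq`** (abstract COLLISION LEMMA, any `G`, any slots): if two slots `i₀ ≠ i₁`
  carry equivariant `T₀ : ℚ^{E_{i₀}} → V`, `T₁ : ℚ^{E_{i₁}} → V` (any `ℚ`-module `V` with a `G`-action) whose
  evaluation vectors COINCIDE and are non-zero, `T₀(u_1(Φ_{i₀})) = T₁(u_1(Φ_{i₁})) ≠ 0`, then `ext_{i₀} U(Φ_{i₀}) ⊄ U(Σ)`
  (the functional `T₀ ∘ res_{i₀} − T₁ ∘ res_{i₁}` kills every simultaneous translate `u_g(Σ)` but not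
  `ext_{i₀} u_1(Φ_{i₀})`); rank form **`IrrOdd.typeRank_sigmaType_add_card_lt_of_eval_eq`**: `rank(Σ) + |I| < Σ_i rank(Φ_i) + 1`.
  (The easy direction of the evaluation criterion, in the shape needed here.)
* §2 **`span_precomp_antiVec_eq_antiWeights`** — for a GALOIS CM field `M` and a NONDEGENERATE type `Ψ` the
  PRE-composition translates `z ↦ u_1(Ψ)(z ∘ δ)` (`δ ∈ Gal(M/ℚ)`) span all odd weights: through a base embedding the
  post- and pre-composition translates are the rows and columns of ONE matrix `(γ, δ) ↦ u_1(Ψ)(z₀ ∘ γ ∘ δ)`, row rank = column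
  rank (`Matrix.rank_transpose`), and the rows span `Anti` by nondegeneracy.
  **`shadow_eq_zero_of_cmFamilyRank_add_card_eq_of_isNondegenerate`** — `K_{i₁}` Galois, `Φ_{i₁}` nondegenerate,
  `j : K_{i₁} → K_{i₀}`: `cmFamilyRank Φ + 2 = Σ cmTypeRank + 1` ⟹ `Φ_{i₀}` is EQUIDISTRIBUTED over `j(K_{i₁})`.  PROOF: the
  push-forward `w = (res_j)_* u_1(Φ_{i₀}) ∈ ℚ^{Hom(K_{i₁}, ℂ)}` (the SHADOW of this seat's gen 49) is odd, hence
  `w = Σ_k c_k u_1(Φ_{i₁})(· ∘ δ_k) = T₁(u_1(Φ_{i₁}))` with `T₁ = Σ_k c_k R_{δ_k}` EQUIVARIANT (pre-composition by `Gal(M/ℚ)`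
  commutes with post-composition by `Aut(ℂ)`); `T₀ = (res_j)_*` is equivariant with `T₀(u_1(Φ_{i₀})) = w`; if `Φ_{i₀}` is
  not equidistributed, `w ≠ 0` and §1 applies.
* §3 THE EXACT CRITERIA — **`cmFamilyRank_add_card_eq_pair_iff_shadow_eq_zero`**: for `K_{i₁}` Galois CM with a
  nondegenerate type (e.g. ANY type of an imaginary quadratic field, a primitive type of `ℚ(ζ_p)`, …) and
  `j : K_{i₁} → K_{i₀}`: `Hg(A₀ × A₁) = Hg(A₀) × Hg(A₁)` **iff** `Φ_{i₀}` is equidistributed over `j(K_{i₁})`;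
  **`forall_hodgeClassesProductSpan_pair_iff_shadow_eq_zero`**: every Hodge class on every `A₀^a × A₁^b` is a sum of
  products **iff** equidistributed (gen 60 G7); `exists_not_hodgeClassesProductSpan_pair_of_shadow_ne_zero`.  File O5 is
  the quadratic case (there via the tree's shared-quadratic obstruction); here one nondegenerate partner over ANY Galois
  CM subfield DETECTS non-equidistribution.

## References

* [Gordon1999HodgeAVSurvey] B. B. Gordon, *A survey of the Hodge conjecture for abelian varieties*, §3 Theorem (proof),
  7.5–7.7, 9.4.3.
* [Kubota1965] T. Kubota, *On the field extension by complex multiplication*, Trans. AMS 118 (1965), §2, §4 Lemma 2.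
* [Deligne1982HodgeCycles] P. Deligne, *Hodge cycles on abelian varieties*, LNM 900 (1982), I Ex. 3.7, §4.
* [MoonenZarhin1999LowDim] B. Moonen, Yu. Zarhin, Math. Ann. 315 (1999), §3 (3.1).
* [Shimura1998] G. Shimura, *Abelian Varieties with Complex Multiplication and Modular Functions*, §8.1, §18.2.
-/

set_option autoImplicit false

noncomputable section

open scoped BigOperators Classical Matrix

open CategoryTheory CategoryTheory.Limits NumberField Module

universe u v w

namespace Summit.HodgeConjecture.CorCM

/-! ### §1 The collision lemma -/

namespace IrrOdd

open Literature.NumberTheory.ComplexMultiplication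

variable {G : Type w} [Group G] {I : Type u} {E : I → Type v} [∀ i, MulAction G (E i)] [DecidableEq I]

/-- **COLLISION LEMMA.**  If equivariant `T₀ : ℚ^{E_{i₀}} → V`, `T₁ : ℚ^{E_{i₁}} → V` (`i₀ ≠ i₁`; `V` any `ℚ`-module with
maps `π g : V → V` intertwined by the `T`'s) have `T₀(u_1(Φ_{i₀})) = T₁(u_1(Φ_{i₁})) ≠ 0`, then `ext_{i₀} U(Φ_{i₀}) ⊄ U(Σ)`: the
family is NOT additive.  (`L = T₀ ∘ res_{i₀} − T₁ ∘ res_{i₁}` vanishes on every `u_g(Σ)`, whose slot restrictions are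
`u_g(Φ_{i₀})`, `u_g(Φ_{i₁})`, but `L(ext_{i₀} u_1(Φ_{i₀})) = T₀(u_1(Φ_{i₀})) ≠ 0`.) [cite: Gordon1999HodgeAVSurvey, §3 Theorem (proof)] -/
theorem not_map_slotExt_le_of_eval_eq {Φ : ∀ i, Set (E i)} {i₀ i₁ : I} (h01 : i₀ ≠ i₁) {V : Type*} [AddCommGroup V]
    [Module ℚ V] (π : G → V → V) (T₀ : (E i₀ → ℚ) →ₗ[ℚ] V) (T₁ : (E i₁ → ℚ) →ₗ[ℚ] V)
    (hT₀ : ∀ (g : G) (f : E i₀ → ℚ), T₀ (fun x => f (g⁻¹ • x)) = π g (T₀ f))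
    (hT₁ : ∀ (g : G) (f : E i₁ → ℚ), T₁ (fun x => f (g⁻¹ • x)) = π g (T₁ f))
    (heq : T₀ (antiVec (Φ i₀) (1 : G)) = T₁ (antiVec (Φ i₁) (1 : G))) (hne : T₀ (antiVec (Φ i₀) (1 : G)) ≠ 0) :
    ¬ (antiSpan G (Φ i₀)).map (slotExt i₀) ≤ antiSpan G (sigmaType Φ) := by
  intro hle
  let L : ((Σ i, E i) → ℚ) →ₗ[ℚ] V :=
    T₀ ∘ₗ LinearMap.funLeft ℚ ℚ (Sigma.mk i₀) - T₁ ∘ₗ LinearMap.funLeft ℚ ℚ (Sigma.mk i₁)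
  -- `L` kills `U(Σ)`
  have hL : ∀ f ∈ antiSpan G (sigmaType Φ), L f = 0 := by
    intro f hf
    induction hf using Submodule.span_induction with
    | mem f hf =>
      obtain ⟨g, rfl⟩ := hf
      change T₀ (LinearMap.funLeft ℚ ℚ (Sigma.mk i₀) (antiVec (sigmaType Φ) g)) -
        T₁ (LinearMap.funLeft ℚ ℚ (Sigma.mk i₁) (antiVec (sigmaType Φ) g)) = 0
      rw [funLeft_mk_antiVec_sigmaType, funLeft_mk_antiVec_sigmaType, antiVec_eq_antiVec_one_comp_smul (Φ i₀) g,
        antiVec_eq_antiVec_one_comp_smul (Φ i₁) g, hT₀, hT₁, heq, sub_self]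
    | zero => exact map_zero L
    | add f f' _ _ hf hf' => rw [map_add, hf, hf', add_zero]
    | smul c f _ hf => rw [map_smul, hf, smul_zero]
  -- but not `ext_{i₀} u_1(Φ_{i₀})`
  have hmem : slotExt i₀ (antiVec (Φ i₀) (1 : G)) ∈ antiSpan G (sigmaType Φ) :=
    hle ⟨antiVec (Φ i₀) (1 : G), Submodule.subset_span ⟨1, rfl⟩, rfl⟩
  have h0 := hL _ hmem
  have h1 : L (slotExt i₀ (antiVec (Φ i₀) (1 : G))) = T₀ (antiVec (Φ i₀) (1 : G)) := by
    change T₀ (LinearMap.funLeft ℚ ℚ (Sigma.mk i₀) (slotExt i₀ (antiVec (Φ i₀) (1 : G)))) -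
      T₁ (LinearMap.funLeft ℚ ℚ (Sigma.mk i₁) (slotExt i₀ (antiVec (Φ i₀) (1 : G)))) = _
    rw [funLeft_mk_slotExt, funLeft_mk_slotExt, dif_pos rfl, dif_neg (Ne.symm h01), map_zero, sub_zero]
  exact hne (h1 ▸ h0)

variable [Fintype I] [∀ i, Fintype (E i)] [Nonempty I] [∀ i, Nonempty (E i)]

/-- **Rank form of the collision lemma**: a collision `T₀(u_1(Φ_{i₀})) = T₁(u_1(Φ_{i₁})) ≠ 0` forces
`rank(Σ) + |I| < Σ_i rank(Φ_i) + 1` (`dim Hg(∏ A_i) < Σ dim Hg(A_i)`). [cite: Gordon1999HodgeAVSurvey, §3 Theorem (proof) and 7.5] -/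
theorem typeRank_sigmaType_add_card_lt_of_eval_eq {ρ : G} {Φ : ∀ i, Set (E i)} (h : ∀ i, IsCMTypeWith ρ (Φ i))
    {i₀ i₁ : I} (h01 : i₀ ≠ i₁) {V : Type*} [AddCommGroup V] [Module ℚ V] (π : G → V → V)
    (T₀ : (E i₀ → ℚ) →ₗ[ℚ] V) (T₁ : (E i₁ → ℚ) →ₗ[ℚ] V)
    (hT₀ : ∀ (g : G) (f : E i₀ → ℚ), T₀ (fun x => f (g⁻¹ • x)) = π g (T₀ f))
    (hT₁ : ∀ (g : G) (f : E i₁ → ℚ), T₁ (fun x => f (g⁻¹ • x)) = π g (T₁ f))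
    (heq : T₀ (antiVec (Φ i₀) (1 : G)) = T₁ (antiVec (Φ i₁) (1 : G))) (hne : T₀ (antiVec (Φ i₀) (1 : G)) ≠ 0) :
    typeRank G (sigmaType Φ) + Fintype.card I < (∑ i, typeRank G (Φ i)) + 1 := by
  refine lt_of_le_of_ne (typeRank_sigmaType_add_card_le h) fun hEq => ?_
  exact not_map_slotExt_le_of_eval_eq h01 π T₀ T₁ hT₀ hT₁ heq hne
    (((forall_map_slotExt_le_iff_typeRank_sigmaType_add_card_eq h).2 hEq) i₀)

end IrrOdd

/-! ### §2 CM fields: a nondegenerate partner over a Galois subfield detects non-equidistribution -/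

section CM

open Literature.NumberTheory.ComplexMultiplication
open Literature.AlgebraicGeometry.Motives (AbelianVariety CMType)
open Literature.AlgebraicGeometry.HodgeTheory
open Literature.AlgebraicGeometry.ComplexMultiplication (IsCMTypeRealisation)
open Literature.AlgebraicGeometry.Pohlmann1968

variable {I : Type} [Fintype I] {K : I → Type} [∀ i, Field (K i)] [∀ i, NumberField (K i)] [∀ i, IsCMField (K i)]

/-- The push-forward of a weight on `Hom(K, ℂ)` along restriction to a subfield `M` (`j : M → K`), `z ↦ Σ_{t ∘ j = z} f(t)`,
intertwines the actions of `Aut(ℂ)`. [cite: Shimura1998, §8.1] -/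
private theorem pushforward_smul {M L : Type} [Field M] [Field L] [NumberField L] (j : M →+* L) (g : ℂ ≃+* ℂ) (f : (L →+* ℂ) → ℚ)
    (z : M →+* ℂ) :
    ∑ t ∈ Finset.univ.filter (fun t : L →+* ℂ => t.comp j = z), f (g⁻¹ • t) =
      ∑ t ∈ Finset.univ.filter (fun t : L →+* ℂ => t.comp j = g⁻¹ • z), f t := by
  rw [Finset.sum_filter, Finset.sum_filter]
  refine Fintype.sum_equiv (MulAction.toPerm g⁻¹) _ _ fun t => ?_
  have hiff : t.comp j = z ↔ (g⁻¹ • t).comp j = g⁻¹ • z := by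
    constructor
    · intro ht
      rw [← ht]
      exact RingHom.ext fun m => rfl
    · intro ht
      have h2 : g • ((g⁻¹ • t).comp j) = g • (g⁻¹ • z) := by rw [ht]
      rw [smul_inv_smul] at h2
      rw [← h2]
      exact RingHom.ext fun m => (g.apply_symm_apply (t (j m))).symm
  simp only [MulAction.toPerm_apply, hiff]

/-- **For a GALOIS CM field `M` and a NONDEGENERATE type `Ψ`, the PRE-composition translates `z ↦ u_1(Ψ)(z ∘ δ)`
(`δ ∈ Gal(M/ℚ)`) span ALL odd weights on `Hom(M, ℂ)`.**  (Through a base embedding `z₀` the post-composition translates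
of `u_1(Ψ)` are the ROWS and the pre-composition translates the COLUMNS of the matrix `(γ, δ) ↦ u_1(Ψ)(z₀ ∘ γ ∘ δ)`; row
rank = column rank; the rows span `Anti` by nondegeneracy.) [cite: Kubota1965, §2 (Lemma 1)] [cite: Shimura1998, §8.1 and §32.10] -/
theorem span_precomp_antiVec_eq_antiWeights {M : Type} [Field M] [NumberField M] [IsCMField M] [IsGalois ℚ M]
    (Ψ : CMType M) (hnd : IsNondegenerate Ψ) :
    Submodule.span ℚ (Set.range fun δ : M ≃ₐ[ℚ] M => fun z : M →+* ℂ =>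
        antiVec Ψ.1 (1 : ℂ ≃+* ℂ) (z.comp (δ : M →+* M))) =
      antiWeights (E := M →+* ℂ) (starRingAut : ℂ ≃+* ℂ) := by
  classical
  haveI : Fintype (M ≃ₐ[ℚ] M) := Fintype.ofFinite _
  obtain ⟨z₀⟩ : Nonempty (M →+* ℂ) := inferInstance
  set u : (M →+* ℂ) → ℚ := antiVec Ψ.1 (1 : ℂ ≃+* ℂ) with hu
  -- the base-point bijection `δ ↦ z₀ ∘ δ` and the pull-back `P`
  let e : (M ≃ₐ[ℚ] M) → (M →+* ℂ) := fun δ => z₀.comp (δ : M →+* M)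
  have he : Function.Surjective e := fun z => by
    obtain ⟨γ, hγ⟩ := exists_algEquiv_comp_eq z₀ z
    exact ⟨γ, RingHom.ext fun x => hγ x⟩
  let P : ((M →+* ℂ) → ℚ) →ₗ[ℚ] ((M ≃ₐ[ℚ] M) → ℚ) := LinearMap.funLeft ℚ ℚ e
  have hP : Function.Injective P := LinearMap.funLeft_injective_of_surjective ℚ ℚ e he
  -- the matrix `B γ δ = u(z₀ ∘ γ ∘ δ)`
  let B : Matrix (M ≃ₐ[ℚ] M) (M ≃ₐ[ℚ] M) ℚ := fun γ δ => u (z₀.comp ((γ * δ : M ≃ₐ[ℚ] M) : M →+* M))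
  -- pre-composition translates pull back to the COLUMNS
  have hR : P '' (Set.range fun δ : M ≃ₐ[ℚ] M => fun z : M →+* ℂ => u (z.comp (δ : M →+* M))) = Set.range B.col := by
    ext f
    constructor
    · rintro ⟨_, ⟨δ, rfl⟩, rfl⟩
      exact ⟨δ, by funext γ; rfl⟩
    · rintro ⟨δ, rfl⟩
      exact ⟨_, ⟨δ, rfl⟩, by funext γ; rfl⟩
  -- post-composition translates pull back to the ROWS
  have hL : P '' (Set.range fun g : ℂ ≃+* ℂ => antiVec Ψ.1 g) = Set.range Bᵀ.col := by
    ext f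
    constructor
    · rintro ⟨_, ⟨g, rfl⟩, rfl⟩
      obtain ⟨γ, hγ⟩ := exists_algEquiv_comp_eq_smul z₀ g
      refine ⟨γ, ?_⟩
      funext δ
      change u (z₀.comp ((γ * δ : M ≃ₐ[ℚ] M) : M →+* M)) = antiVec Ψ.1 g (z₀.comp (δ : M →+* M))
      rw [antiVec_eq_antiVec_one_comp_smul Ψ.1 g, inv_inv]
      change u _ = u (g • z₀.comp (δ : M →+* M))
      congr 1
      exact RingHom.ext fun x => (hγ (δ x)).symm
    · rintro ⟨γ, rfl⟩
      haveI := isPretransitive_ringEquiv_complex (K := M)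
      obtain ⟨g, hg⟩ := MulAction.exists_smul_eq (ℂ ≃+* ℂ) z₀ (z₀.comp (γ : M →+* M))
      refine ⟨antiVec Ψ.1 g, ⟨g, rfl⟩, ?_⟩
      funext δ
      change antiVec Ψ.1 g (z₀.comp (δ : M →+* M)) = u (z₀.comp ((γ * δ : M ≃ₐ[ℚ] M) : M →+* M))
      rw [antiVec_eq_antiVec_one_comp_smul Ψ.1 g, inv_inv]
      change u (g • z₀.comp (δ : M →+* M)) = u _
      congr 1
      refine RingHom.ext fun x => ?_
      change g (z₀ (δ x)) = z₀ (γ (δ x))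
      exact RingHom.congr_fun hg (δ x)
  -- dimension count: column rank = row rank = dim U(Ψ) = dim Anti
  have hU : antiSpan (ℂ ≃+* ℂ) Ψ.1 = antiWeights (E := M →+* ℂ) (starRingAut : ℂ ≃+* ℂ) := by
    rw [← (isCMTypeWith_conj Ψ).typeRank_eq_iff_antiSpan_eq, Embeddings.card M ℂ]
    exact hnd
  have hle : Submodule.span ℚ (Set.range fun δ : M ≃ₐ[ℚ] M => fun z : M →+* ℂ => u (z.comp (δ : M →+* M))) ≤
      antiWeights (E := M →+* ℂ) (starRingAut : ℂ ≃+* ℂ) := by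
    refine Submodule.span_le.2 ?_
    rintro _ ⟨δ, rfl⟩
    rw [SetLike.mem_coe, mem_antiWeights_iff']
    intro z
    change u (((starRingAut : ℂ ≃+* ℂ) • z).comp (δ : M →+* M)) = -u (z.comp (δ : M →+* M))
    have : ((starRingAut : ℂ ≃+* ℂ) • z).comp (δ : M →+* M) = (starRingAut : ℂ ≃+* ℂ) • z.comp (δ : M →+* M) :=
      RingHom.ext fun _ => rfl
    rw [this]
    exact mem_antiWeights_iff'.1 (antiVec_mem_antiWeights (isCMTypeWith_conj Ψ) (1 : ℂ ≃+* ℂ)) _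
  refine Submodule.eq_of_le_of_finrank_eq hle ?_
  have h1 : finrank ℚ (Submodule.span ℚ (Set.range fun δ : M ≃ₐ[ℚ] M => fun z : M →+* ℂ =>
      u (z.comp (δ : M →+* M)))) = finrank ℚ (Submodule.span ℚ (Set.range B.col)) := by
    rw [LinearEquiv.finrank_eq (Submodule.equivMapOfInjective P hP _), Submodule.map_span, hR]
  have h2 : finrank ℚ (antiSpan (ℂ ≃+* ℂ) Ψ.1) = finrank ℚ (Submodule.span ℚ (Set.range Bᵀ.col)) := by
    rw [LinearEquiv.finrank_eq (Submodule.equivMapOfInjective P hP _), antiSpan, Submodule.map_span, hL]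
  rw [h1, ← Matrix.rank_eq_finrank_span_cols, ← Matrix.rank_transpose, Matrix.rank_eq_finrank_span_cols, ← h2, hU]

/-- **A NONDEGENERATE PARTNER OVER A GALOIS SUBFIELD DETECTS NON-EQUIDISTRIBUTION.**  Two slots `i₀ ≠ i₁`; `K_{i₁}` a
GALOIS CM field embedded in `K_{i₀}` by `j`; `Φ_{i₁}` NONDEGENERATE.  If the family is additive
(`cmFamilyRank Φ + |I| = Σ_i cmTypeRank Φ_i + 1`; for the two-slot family: `Hg(A₀ × A₁) = Hg(A₀) × Hg(A₁)`), then `Φ_{i₀}` is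
EQUIDISTRIBUTED over `j(K_{i₁})`: every embedding `z` of `K_{i₁}` has exactly `[K_{i₀} : K_{i₁}]/2` extensions in `Φ_{i₀}`.
(Otherwise the shadow `w = (res_j)_* u_1(Φ_{i₀})` is a non-zero odd weight on `Hom(K_{i₁}, ℂ)`, hence in
`Anti`, which is spanned by the PRE-composition translates of `u_1(Φ_{i₁})` (`span_precomp_antiVec_eq_antiWeights`), so
`w = T₁(u_1(Φ_{i₁}))` for an equivariant `T₁ = Σ_k c_k R_{δ_k}` (pre-compositions commute with `Aut(ℂ)`), and the collision
lemma applies with `T₀ = (res_j)_*`.) [cite: Kubota1965, §2 and §4 Lemma 2] [cite: Gordon1999HodgeAVSurvey, §3 Theorem (proof), 7.5 and 9.4.3] -/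
theorem shadow_eq_zero_of_cmFamilyRank_add_card_eq_of_isNondegenerate {i₀ i₁ : I} (h01 : i₀ ≠ i₁)
    [IsGalois ℚ (K i₁)] (Φ : ∀ i, CMType (K i)) (hnd : IsNondegenerate (Φ i₁)) (j : K i₁ →+* K i₀)
    (hadd : CMAlgebra.cmFamilyRank Φ + Fintype.card I = (∑ i, cmTypeRank (Φ i)) + 1) (z : K i₁ →+* ℂ) :
    2 * (Finset.univ.filter fun t : K i₀ →+* ℂ => t.comp j = z ∧ t ∈ (Φ i₀).1).card =
      (Finset.univ.filter fun t : K i₀ →+* ℂ => t.comp j = z).card := by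
  haveI : Nonempty I := ⟨i₀⟩
  haveI : ∀ i, Nonempty (K i →+* ℂ) := fun i => inferInstance
  by_contra hz
  -- notation
  let G := ℂ ≃+* ℂ
  let V := (K i₁ →+* ℂ) → ℚ
  let π : G → V → V := fun g f y => f (g⁻¹ • y)
  let u₀ : (K i₀ →+* ℂ) → ℚ := antiVec (Φ i₀).1 (1 : G)
  let u₁ : V := antiVec (Φ i₁).1 (1 : G)
  -- `T₀ = (res_j)_*`
  let T₀ : ((K i₀ →+* ℂ) → ℚ) →ₗ[ℚ] V :=
    { toFun := fun f y => ∑ t ∈ Finset.univ.filter (fun t : K i₀ →+* ℂ => t.comp j = y), f t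
      map_add' := fun f f' => by
        funext y
        simp only [Pi.add_apply]
        exact Finset.sum_add_distrib
      map_smul' := fun c f => by
        funext y
        change ∑ x ∈ Finset.univ.filter (fun t : K i₀ →+* ℂ => t.comp j = y), c * f x =
          c * ∑ t ∈ Finset.univ.filter (fun t : K i₀ →+* ℂ => t.comp j = y), f t
        rw [Finset.mul_sum] }
  have hT₀ : ∀ (g : G) (f : (K i₀ →+* ℂ) → ℚ), T₀ (fun x => f (g⁻¹ • x)) = π g (T₀ f) := fun g f => by
    funext y
    exact pushforward_smul j g f y
  -- the shadow `w = T₀ u₀` is non-zero at `z`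
  set w : V := T₀ u₀ with hw
  have hwz : w z ≠ 0 := by
    intro h0
    apply hz
    have h1 : w z = 2 * ((Finset.univ.filter fun t : K i₀ →+* ℂ => t.comp j = z ∧ t ∈ (Φ i₀).1).card : ℚ) -
        ((Finset.univ.filter fun t : K i₀ →+* ℂ => t.comp j = z).card : ℚ) := by
      change ∑ t ∈ Finset.univ.filter (fun t : K i₀ →+* ℂ => t.comp j = z), antiVec (Φ i₀).1 (1 : G) t = _
      simp only [antiVec, translateInd, one_smul, Finset.sum_sub_distrib, Finset.sum_const, nsmul_eq_mul, mul_one,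
        ← Finset.mul_sum, Finset.sum_boole, Finset.filter_filter]
    rw [h1, sub_eq_zero] at h0
    exact_mod_cast h0
  have hne : T₀ u₀ ≠ 0 := fun h0 => hwz (by rw [hw, h0]; rfl)
  -- `w` is odd, hence in `Anti = U(Φ_{i₁})`
  have hodd : w ∈ antiWeights (E := K i₁ →+* ℂ) (starRingAut : ℂ ≃+* ℂ) := by
    rw [mem_antiWeights_iff']
    intro y
    change ∑ t ∈ Finset.univ.filter (fun t : K i₀ →+* ℂ => t.comp j = (starRingAut : G) • y), u₀ t =
      -∑ t ∈ Finset.univ.filter (fun t : K i₀ →+* ℂ => t.comp j = y), u₀ t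
    have h1 := pushforward_smul j (starRingAut : G)⁻¹ u₀ y
    rw [inv_inv] at h1
    rw [← h1, ← Finset.sum_neg_distrib]
    refine Finset.sum_congr rfl fun t _ => ?_
    exact mem_antiWeights_iff'.1 (antiVec_mem_antiWeights (isCMTypeWith_conj (Φ i₀)) (1 : G)) t
  -- `Anti` is spanned by the pre-composition translates of `u₁` (Galois + nondegenerate)
  have hwU : w ∈ Submodule.span ℚ (Set.range fun δ : K i₁ ≃ₐ[ℚ] K i₁ => fun y : K i₁ →+* ℂ =>
      antiVec (Φ i₁).1 (1 : ℂ ≃+* ℂ) (y.comp (δ : K i₁ →+* K i₁))) := by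
    rw [span_precomp_antiVec_eq_antiWeights (Φ i₁) hnd]
    exact hodd
  -- every element of that span is `T₁ u₁` for an equivariant `T₁` (pre-compositions commute with `Aut(ℂ)`)
  have hT₁ : ∀ v ∈ Submodule.span ℚ (Set.range fun δ : K i₁ ≃ₐ[ℚ] K i₁ => fun y : K i₁ →+* ℂ =>
      antiVec (Φ i₁).1 (1 : ℂ ≃+* ℂ) (y.comp (δ : K i₁ →+* K i₁))), ∃ T₁ : V →ₗ[ℚ] V,
      (∀ (g : G) (f : V), T₁ (fun x => f (g⁻¹ • x)) = π g (T₁ f)) ∧ T₁ u₁ = v := by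
    intro v hv
    induction hv using Submodule.span_induction with
    | mem v hv =>
      obtain ⟨δ, rfl⟩ := hv
      refine ⟨LinearMap.funLeft ℚ ℚ fun y : K i₁ →+* ℂ => y.comp (δ : K i₁ →+* K i₁), fun g' f => ?_, ?_⟩
      · funext y
        change f ((g'⁻¹ • y).comp (δ : K i₁ →+* K i₁)) = f (g'⁻¹ • y.comp (δ : K i₁ →+* K i₁))
        rfl
      · rfl
    | zero => exact ⟨0, fun g f => by funext y; rfl, by simp⟩
    | add v v' _ _ hv hv' =>
      obtain ⟨T, hT, hTu⟩ := hv
      obtain ⟨T', hT', hTu'⟩ := hv'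
      refine ⟨T + T', fun g f => ?_, by simp [hTu, hTu']⟩
      rw [LinearMap.add_apply, LinearMap.add_apply, hT g f, hT' g f]
      funext y
      rfl
    | smul c v _ hv =>
      obtain ⟨T, hT, hTu⟩ := hv
      refine ⟨c • T, fun g f => ?_, by simp [hTu]⟩
      rw [LinearMap.smul_apply, LinearMap.smul_apply, hT g f]
      funext y
      rfl
  obtain ⟨T₁, hT₁eq, hT₁u⟩ := hT₁ w hwU
  -- collision
  have hlt := IrrOdd.typeRank_sigmaType_add_card_lt_of_eval_eq (G := G) (Φ := fun i => (Φ i).1)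
    (fun i => isCMTypeWith_conj (Φ i)) h01 π T₀ T₁ hT₀ hT₁eq (by rw [hT₁u]) hne
  exact absurd hadd (ne_of_lt hlt)

/-! ### §3 The exact criteria -/

/-- **THE EXACT CRITERION (Galois subfield, nondegenerate partner).**  Two-slot family `{i₀, i₁}`, `K_{i₁}` a Galois
CM field embedded in `K_{i₀}` by `j`, `Φ_{i₁}` nondegenerate (e.g. ANY type of an imaginary quadratic field).  Then
`Hg(A₀ × A₁) = Hg(A₀) × Hg(A₁)` (`cmFamilyRank Φ + 2 = Σ cmTypeRank + 1`) **iff `Φ_{i₀}` is equidistributed over `j(K_{i₁})`**.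
[cite: Kubota1965, §2 and §4 Lemma 2] [cite: Gordon1999HodgeAVSurvey, §3 Theorem (proof), 7.5–7.7 and 9.4.3] -/
theorem cmFamilyRank_add_card_eq_pair_iff_shadow_eq_zero {i₀ i₁ : I} (h01 : i₀ ≠ i₁) (hI : ∀ l, l = i₀ ∨ l = i₁)
    [IsGalois ℚ (K i₁)] (Φ : ∀ i, CMType (K i)) (hnd : IsNondegenerate (Φ i₁)) (j : K i₁ →+* K i₀) :
    CMAlgebra.cmFamilyRank Φ + Fintype.card I = (∑ i, cmTypeRank (Φ i)) + 1 ↔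
      ∀ z : K i₁ →+* ℂ, 2 * (Finset.univ.filter fun t : K i₀ →+* ℂ => t.comp j = z ∧ t ∈ (Φ i₀).1).card =
        (Finset.univ.filter fun t : K i₀ →+* ℂ => t.comp j = z).card :=
  ⟨fun hadd z => shadow_eq_zero_of_cmFamilyRank_add_card_eq_of_isNondegenerate h01 Φ hnd j hadd z,
    fun hbal => cmFamilyRank_add_card_eq_pair_of_shadow_eq_zero h01 hI Φ j hbal⟩

variable {Φ : ∀ i, CMType (K i)} {A : I → AbelianVariety ℂ} {ιA : ∀ i, 𝓞 (K i) →+* End (A i)}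
  {θ : ∀ i, K i →+* Module.End ℂ (complexBetti (A i).X 1)}

/-- **EVERY HODGE CLASS ON EVERY `A₀^a × A₁^b` IS A SUM OF PRODUCTS ⟺ `Φ_{i₀}` IS EQUIDISTRIBUTED OVER `j(K_{i₁})`**, for
realisations `A_i ⊨ (K_i; Φ_i)` with `K_{i₁}` Galois and `Φ_{i₁}` nondegenerate (the left side quantifies over all
disjoint slot maps `π₁`, `π₂`; gen 60 G7). [cite: MoonenZarhin1999LowDim, §3 (3.1)] [cite: Gordon1999HodgeAVSurvey, 7.5–7.7 and 9.4.3] -/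
theorem forall_hodgeClassesProductSpan_pair_iff_shadow_eq_zero {i₀ i₁ : I} (h01 : i₀ ≠ i₁)
    (hI : ∀ l, l = i₀ ∨ l = i₁) [IsGalois ℚ (K i₁)] (hnd : IsNondegenerate (Φ i₁)) (j : K i₁ →+* K i₀)
    (hA : ∀ i, IsCMTypeRealisation (Φ i) (A i) (ιA i) (θ i)) :
    (∀ (N₁ N₂ : ℕ) [NeZero N₁] [NeZero N₂] (π₁ : Fin N₁ → I) (π₂ : Fin N₂ → I), (∀ j₁ j₂, π₁ j₁ ≠ π₂ j₂) →
        HodgeClassesProductSpan (⨁ fun l => A (π₁ l)) (⨁ fun l => A (π₂ l))) ↔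
      ∀ z : K i₁ →+* ℂ, 2 * (Finset.univ.filter fun t : K i₀ →+* ℂ => t.comp j = z ∧ t ∈ (Φ i₀).1).card =
        (Finset.univ.filter fun t : K i₀ →+* ℂ => t.comp j = z).card := by
  haveI : Nonempty I := ⟨i₀⟩
  exact (cmFamilyRank_add_card_eq_iff_forall_hodgeClassesProductSpan hA).symm.trans
    (cmFamilyRank_add_card_eq_pair_iff_shadow_eq_zero h01 hI Φ hnd j)

/-- **Not equidistributed ⟹ a MIXED exceptional Hodge class**: if some embedding `z` of the Galois field `K_{i₁}` has
`2·#{t ∈ Φ_{i₀} | t ∘ j = z} ≠ #{t | t ∘ j = z}` and `Φ_{i₁}` is nondegenerate (`K_{i₁}` Galois), some `(⨁_l A_{π₁ l}) × (⨁_l A_{π₂ l})` with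
disjoint slot maps carries a rational Hodge class which is NOT a combination of exterior products of Hodge classes of the
factors. [cite: MoonenZarhin1999LowDim, Thm. (0.1) (a) and §3 (3.1)] [cite: Gordon1999HodgeAVSurvey, 7.5 and 9.4.3] -/
theorem exists_not_hodgeClassesProductSpan_pair_of_shadow_ne_zero {i₀ i₁ : I} (h01 : i₀ ≠ i₁)
    [IsGalois ℚ (K i₁)] (hnd : IsNondegenerate (Φ i₁)) (j : K i₁ →+* K i₀)
    (hA : ∀ i, IsCMTypeRealisation (Φ i) (A i) (ιA i) (θ i))
    (hz : ∃ z : K i₁ →+* ℂ, 2 * (Finset.univ.filter fun t : K i₀ →+* ℂ => t.comp j = z ∧ t ∈ (Φ i₀).1).card ≠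
      (Finset.univ.filter fun t : K i₀ →+* ℂ => t.comp j = z).card) :
    ∃ (N₁ N₂ : ℕ) (_ : NeZero N₁) (_ : NeZero N₂) (π₁ : Fin N₁ → I) (π₂ : Fin N₂ → I),
      (∀ j₁ j₂, π₁ j₁ ≠ π₂ j₂) ∧ ¬ HodgeClassesProductSpan (⨁ fun l => A (π₁ l)) (⨁ fun l => A (π₂ l)) := by
  haveI : Nonempty I := ⟨i₀⟩
  obtain ⟨z, hz⟩ := hz
  exact exists_not_hodgeClassesProductSpan_of_cmFamilyRank_add_card_ne hA fun hadd =>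
    hz (shadow_eq_zero_of_cmFamilyRank_add_card_eq_of_isNondegenerate h01 Φ hnd j hadd z)

end CM

end Summit.HodgeConjecture.CorCM

end
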